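import Summits.BirchSwinnertonDyer.BirchSwinnertonDyer.Theorems.ClassRecordThreeEulerHalvesAtThreeCartanTorusCubeCutPSChar
import Mathlib.Algebra.Group.Conj
import HarnessLib

/-!
# Crux 19109 `EulerHalvesAtThree` ∕ 23422 line `cartan` v8′, stub (F2a): the TORUS-CUBE CUT of S-K1′ — towards input (C2):
# the cubic new-vector character MOD 3 (`χ_W(M) ≡ 1 + #roots − [M scalar]`) and conjugation of the double sum `S₃(g)`

Seat `bsd-stepL-tam3-p1` g21 (LINE OWNER of crux 23422; `--supports stmt-BirchSwinnertonDyer-23422 --as helper`). CONTENT, all PROVED,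
for the cuspidal case `q ≡ 2 (mod 3)`, `q ≥ 5`:
* §1 `rootCount M = #{x ∈ 𝔽_q : x² − tr M·x + det M = 0}` (the rational eigenvalues) is `1` if the discriminant vanishes, `2` if it does
  not and there is a rational eigenvalue, `0` otherwise (`q` odd); hence **`χ_W(M) ≡ 1 + rootCount M − [M scalar] (mod 3)`**
  (`char_mod_three`): the five values `q − 1, −1, 0, −2, 1` of `cubicNewvectorCharMat` against `1+1−1, 1+1, 1+2, 1+0, 1+0`. This replaces
  the count of fixed points on `P¹(𝔽_q)` of the card `Lines/cartan_sk1.md` by a count of roots, with the scalar correction explicit.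
* §2 conjugation: `T_C(gηg⁻¹) = g T_C(η) g⁻¹`, the same for the cubes, and
  **`S₃(g) = Σ_{s ∈ T_s} Σ_{t ∈ (g T_C g⁻¹)³} χ_W(s·t)`** (`S3_eq_sum_conj`) — so (C2) is a statement about the torus of `η' = gηg⁻¹` at `g = 1`
  (conjugation-invariance of `HasRatEigenvalue` ∕ of the discriminant of scalars: cartan-f2a g0's `PS.hasRatEigenvalue_conj_iff`,
  `PS.discr_eq_zero_of_isScalar`, imported).
HONEST FRAMING: finite-field bookkeeping in `GL₂(𝔽_q)`; nothing about any curve, `L`-value or period; S-K1′ is NOT proved here (inputs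
(C2), (P1)–(P3) of the cut remain at this file); no summit statement, no route item and no registered stub is proved; BSD is proved for no
curve. [folklore; background: cite: Bump1997, §4.1]
-/

namespace Summit.BirchSwinnertonDyer.BirchSwinnertonDyer.Theorems.CartanTorusCubeCut

open Summit.BirchSwinnertonDyer.BirchSwinnertonDyer.Theorems.CartanDegree

open scoped Classical

set_option linter.dupNamespace false
set_option autoImplicit false

noncomputable section

variable {q : ℕ} [Fact q.Prime]

/-! ### §1 Root counts and the character mod 3 -/

/-- the number of rational eigenvalues of `M`: roots in `𝔽_q` of `x² − tr M·x + det M`. -/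
def rootCount (M : Mat q) : ℕ := (Finset.univ.filter (fun x : ZMod q => x * x + M.det = M.trace * x)).card

/-- no rational eigenvalue: `rootCount M = 0`. -/
theorem rootCount_of_not_hasRatEigenvalue {M : Mat q} (h : ¬ HasRatEigenvalue M) : rootCount M = 0 := by
  rw [rootCount, Finset.card_eq_zero, Finset.filter_eq_empty_iff]
  intro x _ hx
  exact h ⟨x, hx⟩

/-- vanishing discriminant (odd `q`): the unique root is `tr M / 2`, `rootCount M = 1`. -/
theorem rootCount_of_disc_eq_zero {M : Mat q} (h2 : (2 : ZMod q) ≠ 0) (hΔ : M.trace ^ 2 - 4 * M.det = 0) :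
    rootCount M = 1 := by
  rw [rootCount, Finset.card_eq_one]
  refine ⟨M.trace * 2⁻¹, ?_⟩
  have h22 : (2 : ZMod q) * 2⁻¹ = 1 := mul_inv_cancel₀ h2
  ext x
  simp only [Finset.mem_filter, Finset.mem_univ, true_and, Finset.mem_singleton]
  constructor
  · intro hx
    -- (x - tr/2)^2 = x^2 - tr x + tr^2/4 = -det + tr^2/4 = Δ/4 = 0
    have hsq : (x - M.trace * 2⁻¹) * (x - M.trace * 2⁻¹) = 0 := by
      linear_combination hx + ((2 : ZMod q)⁻¹ * 2⁻¹) * hΔ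
        + (M.det * (2 * (2 : ZMod q)⁻¹ + 1) - M.trace * x) * h22
    exact sub_eq_zero.1 (mul_self_eq_zero.1 hsq)
  · rintro rfl
    linear_combination (M.det * (2 * (2 : ZMod q)⁻¹ - 1)) * h22 + ((2 : ZMod q)⁻¹ ^ 2 - 2⁻¹) * hΔ

/-- non-vanishing discriminant and a rational eigenvalue `x₁`: the roots are `x₁ ≠ tr M − x₁`, `rootCount M = 2`. -/
theorem rootCount_of_hasRatEigenvalue {M : Mat q} (hΔ : M.trace ^ 2 - 4 * M.det ≠ 0) (h : HasRatEigenvalue M) :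
    rootCount M = 2 := by
  obtain ⟨x₁, hx₁⟩ := h
  have hne : x₁ ≠ M.trace - x₁ := by
    intro he
    apply hΔ
    have ht : M.trace = 2 * x₁ := by linear_combination -he
    rw [ht]
    linear_combination (-4 : ZMod q) * hx₁ + (-4 * x₁) * ht
  rw [rootCount, Finset.card_eq_two]
  refine ⟨x₁, M.trace - x₁, hne, ?_⟩
  ext x
  simp only [Finset.mem_filter, Finset.mem_univ, true_and, Finset.mem_insert, Finset.mem_singleton]
  constructor
  · intro hx
    have hprod : (x - x₁) * (x - (M.trace - x₁)) = 0 := by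
      linear_combination hx - hx₁
    rcases mul_eq_zero.1 hprod with h0 | h0
    · exact Or.inl (sub_eq_zero.1 h0)
    · exact Or.inr (sub_eq_zero.1 h0)
  · rintro (rfl | rfl)
    · exact hx₁
    · linear_combination hx₁

/-- a scalar matrix has a rational eigenvalue. -/
theorem hasRatEigenvalue_of_isScalarMat {M : Mat q} (h : IsScalarMat M) : HasRatEigenvalue M := by
  obtain ⟨h01, h10, h00⟩ := h
  refine ⟨M 1 1, ?_⟩
  rw [Matrix.trace_fin_two, Matrix.det_fin_two, h01, h00]
  ring

omit [Fact q.Prime] in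
/-- `q ≡ 2 (mod 3)` read in `ZMod 3`. -/
theorem natCast_q_eq_two (hq3 : q % 3 = 2) : (q : ZMod 3) = 2 := by
  rw [← ZMod.natCast_mod, hq3]; rfl

/-- **the cubic new-vector character mod 3** (`q ≡ 2 (mod 3)`, `q ≥ 5`): `χ_W(M) ≡ 1 + rootCount M − [M scalar]`. -/
theorem char_mod_three (hq5 : 5 ≤ q) (hq3 : q % 3 = 2) (M : Mat q) :
    ((cubicNewvectorCharMat q M : ℤ) : ZMod 3) =
      1 + (rootCount M : ZMod 3) - (if IsScalarMat M then 1 else 0) := by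
  have hq1 : ¬ q % 3 = 1 := by omega
  have h2 := two_ne_zero_of_five_le hq5
  have hqz := natCast_q_eq_two hq3
  unfold cubicNewvectorCharMat
  simp only [hq1, if_false]
  by_cases hΔ : M.trace ^ 2 - 4 * M.det = 0
  · rw [rootCount_of_disc_eq_zero h2 hΔ]
    simp only [hΔ, if_true]
    by_cases hsc : IsScalarMat M
    · simp only [hsc, if_true]
      push_cast
      rw [hqz]; decide
    · simp only [hsc, if_false]
      push_cast
      decide
  · simp only [hΔ, if_false]
    by_cases hr : HasRatEigenvalue M
    · have hsc : ¬ IsScalarMat M := fun h => hΔ (PS.discr_eq_zero_of_isScalar h)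
      rw [rootCount_of_hasRatEigenvalue hΔ hr]
      simp only [hr, if_true, hsc, if_false]
      push_cast
      decide
    · have hsc : ¬ IsScalarMat M := fun h => hr (hasRatEigenvalue_of_isScalarMat h)
      rw [rootCount_of_not_hasRatEigenvalue hr]
      simp only [hr, if_false, hsc]
      by_cases hp : M ^ ((q ^ 2 - 1) / 3) = 1
      · simp only [hp, if_true]; push_cast; decide
      · simp only [hp, if_false]; push_cast; decide

/-! ### §2 Conjugation -/

section Conj

variable (g : G q) (η : Mat q)

/-- commuting with `gηg⁻¹` is commuting of the `g⁻¹`-conjugate with `η`. -/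
theorem comm_conj_iff (t : G q) :
    (t : Mat q) * ((g : Mat q) * η * ((g⁻¹ : G q) : Mat q)) = ((g : Mat q) * η * ((g⁻¹ : G q) : Mat q)) * t ↔
      ((g⁻¹ * t * g : G q) : Mat q) * η = η * ((g⁻¹ * t * g : G q) : Mat q) := by
  have h1 : ((g⁻¹ : G q) : Mat q) * (g : Mat q) = 1 := by
    rw [← Units.val_mul, inv_mul_cancel, Units.val_one]
  have h2 : (g : Mat q) * ((g⁻¹ : G q) : Mat q) = 1 := by
    rw [← Units.val_mul, mul_inv_cancel, Units.val_one]
  simp only [Units.val_mul]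
  constructor
  · intro h
    calc ((g⁻¹ : G q) : Mat q) * (t : Mat q) * (g : Mat q) * η
        = ((g⁻¹ : G q) : Mat q) * ((t : Mat q) * ((g : Mat q) * η * ((g⁻¹ : G q) : Mat q))) * (g : Mat q) := by
          simp only [mul_assoc, h1, mul_one]
      _ = ((g⁻¹ : G q) : Mat q) * (((g : Mat q) * η * ((g⁻¹ : G q) : Mat q)) * (t : Mat q)) * (g : Mat q) := by rw [h]
      _ = η * (((g⁻¹ : G q) : Mat q) * (t : Mat q) * (g : Mat q)) := by
          simp only [← mul_assoc, h1, one_mul]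
  · intro h
    calc (t : Mat q) * ((g : Mat q) * η * ((g⁻¹ : G q) : Mat q))
        = (g : Mat q) * ((((g⁻¹ : G q) : Mat q) * (t : Mat q) * (g : Mat q)) * η) * ((g⁻¹ : G q) : Mat q) := by
          simp only [← mul_assoc, h2, one_mul]
      _ = (g : Mat q) * (η * (((g⁻¹ : G q) : Mat q) * (t : Mat q) * (g : Mat q))) * ((g⁻¹ : G q) : Mat q) := by rw [h]
      _ = ((g : Mat q) * η * ((g⁻¹ : G q) : Mat q)) * (t : Mat q) := by
          simp only [mul_assoc, h2, mul_one]

/-- **`T_C(gηg⁻¹) = g·T_C(η)·g⁻¹`**. -/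
theorem nonsplitTorus_conj :
    nonsplitTorus ((g : Mat q) * η * ((g⁻¹ : G q) : Mat q)) = (nonsplitTorus η).image (fun t => g * t * g⁻¹) := by
  ext t
  simp only [nonsplitTorus, Finset.mem_filter, Finset.mem_univ, true_and, Finset.mem_image]
  rw [comm_conj_iff]
  constructor
  · intro h
    exact ⟨g⁻¹ * t * g, h, by group⟩
  · rintro ⟨u, hu, rfl⟩
    have : g⁻¹ * (g * u * g⁻¹) * g = u := by group
    rw [this]
    exact hu

/-- **the cubes of `T_C(gηg⁻¹)` are the conjugates of the cubes of `T_C(η)`**. -/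
theorem nonsplitCubes_conj :
    nonsplitCubes ((g : Mat q) * η * ((g⁻¹ : G q) : Mat q)) = (nonsplitCubes η).image (fun t => g * t * g⁻¹) := by
  rw [nonsplitCubes, nonsplitCubes, nonsplitTorus_conj, Finset.image_image, Finset.image_image]
  congr 1
  funext t
  show (g * t * g⁻¹) ^ 3 = g * t ^ 3 * g⁻¹
  exact conj_pow

omit [Fact q.Prime] in
/-- conjugation is injective. -/
theorem conj_injective : Function.Injective (fun t : G q => g * t * g⁻¹) := by
  intro a b h
  simpa using h

/-- **`S₃(g) = Σ_{s ∈ T_s} Σ_{t ∈ T_C(gηg⁻¹)³} χ_W(s·t)`**: (C2) is a statement about the conjugate torus at `g = 1`. -/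
theorem S3_eq_sum_conj :
    S3 q η g = ∑ s ∈ splitTorus q, ∑ t ∈ nonsplitCubes ((g : Mat q) * η * ((g⁻¹ : G q) : Mat q)),
      cubicNewvectorChar q (s * t) := by
  rw [S3, nonsplitCubes_conj]
  refine Finset.sum_congr rfl (fun s _ => ?_)
  rw [Finset.sum_image (fun a _ b _ h => conj_injective g h)]
  refine Finset.sum_congr rfl (fun t _ => ?_)
  congr 1
  group

end Conj

end

end Summit.BirchSwinnertonDyer.BirchSwinnertonDyer.Theorems.CartanTorusCubeCut
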